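import Mathlib.LinearAlgebra.PerfectPairing.Basic
import Mathlib.RingTheory.Flat.Basic
import Mathlib.Algebra.Homology.HomologySequence
import Mathlib.LinearAlgebra.Pi
import Literature.AlgebraicTopology.SingularHomology.SingularChains
import Literature.AlgebraicTopology.SingularHomology.RelativeHomology
import Literature.AlgebraicTopology.SingularHomology.SingularCochains
import Literature.AlgebraicTopology.SingularHomology.CapProduct
import HarnessLib

-- D-0014 sorry-sweep (operator, 2026-08-13): sorried theorems -> named facts `def X : Prop`; partial proofs preserved in comments
-- provenance: harness21/H21/H21/Prelude/AlgTop/Coefficients.lean @ 2141302 (interim HEAD d8f2665); M5 mechanical rewrite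
/-!
# Change of coefficients, universal coefficients and the Bockstein
(trunk G04 AlgTop, item C12 `Coefficients`)

Functoriality of singular (co)homology in the *coefficient* module: an `R`-linear map
`f : M →ₗ[R] N` induces chain maps `C_•(X; M) ⟶ C_•(X; N)`, `C^•(X; M) ⟶ C^•(X; N)` and hence
maps `Hₙ(X; M) ⟶ Hₙ(X; N)`, `Hₙ(X, A; M) ⟶ Hₙ(X, A; N)`, `Hⁿ(X; M) ⟶ Hⁿ(X; N)`
(Hatcher, *Algebraic Topology* (2002), §2.2, "Homology with coefficients", p. 153 ff.), together
with the two universal-coefficient statements consumed downstream (periods with `ℚ`-coefficients,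
T-MOTIVE's `ℚ → ℂ`):

* over a field the Kronecker pairing `Hⁿ(X; R) × Hₙ(X; R) → R` is perfect when `Hₙ` is finite
  dimensional (Hatcher 2002, §3.1, Thm. 3.2 / §3.A, `Hⁿ(X; F) ≅ Hom_F(Hₙ(X; F), F)`);
* for a flat `R`-module `M`, `Hₙ(X; M) ≅ Hₙ(X; R) ⊗[R] M` (Hatcher 2002, §3.A, Thm. 3A.3 and
  Cor. 3A.4; the `Tor` term vanishes for flat `M`);

and the Bockstein homomorphism `β : Hₙ₊₁(X; P) ⟶ Hₙ(X; M)` of a short exact sequence of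
coefficient modules `0 → M → N → P → 0` (Hatcher 2002, §3.E), obtained from Mathlib's
`CategoryTheory.ShortComplex.ShortExact.δ` applied to the short exact sequence of singular chain
complexes `0 → C_•(X; M) → C_•(X; N) → C_•(X; P) → 0`.

Mathlib has the singular chain complex as a functor in the coefficient object
(`AlgebraicTopology.singularChainComplexFunctor C : C ⥤ TopCat ⥤ ChainComplex C ℕ`), which we
use for `singularChainComplex.mapCoeff`; it has `LinearMap.IsPerfPair`, `Module.Flat`,
`TensorProduct` and the homology sequence API, all used here. It has no universal coefficient
theorem or Bockstein for singular homology (searched: `Bockstein`, `universal coefficient`,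
`UniversalCoeff`); the general `Ext`/`Tor` UCT sequences are deferred (outline §4.8).

Conventions (see `Literature.Prelude.AlgTop.SingularChains`): `X : Type u` unbundled, `R : Type v` a
commutative ring, `M N P : Type v` `R`-modules, all objects in `ModuleCat.{max u v} R`; the
coefficient object handed to Mathlib is `ModuleCat.of R (ULift.{u} M)` and the morphism of
coefficient objects induced by `f` is `Literature.coeffHom f` (the `ULift`-conjugate of `f`). Everything is
generic in `R`.

## Main definitions

* `Literature.coeffHom f : ModuleCat.of R (ULift M) ⟶ ModuleCat.of R (ULift N)`.
* `Literature.singularChainComplex.mapCoeff X f : C_•(X; M) ⟶ C_•(X; N)` with `mapCoeff_single`,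
  `mapCoeff_id`, `mapCoeff_comp`, `mapCoeff_zero`, `map_comp_mapCoeff` (naturality in `X`).
* `Literature.singularHomology.mapCoeff X f n`, `Literature.relativeSingularHomology.mapCoeff X A f n`,
  `Literature.singularCochainComplex.mapCoeff X f`, `Literature.singularCohomology.mapCoeff X f n`, with
  functoriality lemmas (all proved).
* `Literature.bockstein X f g hfg hf hg n : Hₙ₊₁(X; P) ⟶ Hₙ(X; M)`.

## Main statements

* `Literature.AlgebraicTopology.SingularHomology.isPerfPair_kroneckerPairing_of_field` (UCT over a field; sorried).
* `Literature.AlgebraicTopology.SingularHomology.nonempty_singularHomology_iso_tensor` (UCT for flat coefficients; sorried).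
* `Literature.AlgebraicTopology.SingularHomology.shortExact_mapCoeff` (chains with coefficients preserve short exact sequences; sorried).

## References

* A. Hatcher, *Algebraic Topology*, CUP 2002, §2.2, §3.1, §3.A, §3.E.
-/

noncomputable section

open CategoryTheory Limits AlgebraicTopology Simplicial Opposite TensorProduct

universe u v

namespace Literature.AlgebraicTopology.SingularHomology

variable {R : Type v} [CommRing R]
variable {M N P : Type v} [AddCommGroup M] [Module R M] [AddCommGroup N] [Module R N]
  [AddCommGroup P] [Module R P]
variable {X Y Z : Type u} [TopologicalSpace X] [TopologicalSpace Y] [TopologicalSpace Z]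

/-! ### The morphism of coefficient objects -/

/-- The morphism of coefficient objects `ModuleCat.of R (ULift M) ⟶ ModuleCat.of R (ULift N)`
induced by an `R`-linear map `f : M →ₗ[R] N`: the `ULift`-conjugate
`ULift.up ∘ f ∘ ULift.down` (Hatcher 2002, §2.2, homomorphism of coefficient groups
`φ : G₁ → G₂`). This is `(ModuleCat.uliftFunctor R).map (ModuleCat.ofHom f)` written out, to keep
the imports light. [cite: Hatcher2002, §2.2  homomorphism of coefficient groups] -/
def coeffHom (f : M →ₗ[R] N) : ModuleCat.of R (ULift.{u} M) ⟶ ModuleCat.of R (ULift.{u} N) :=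
  ModuleCat.ofHom
    (ULift.moduleEquiv.symm.toLinearMap ∘ₗ f ∘ₗ (ULift.moduleEquiv (R := R) (M := M)).toLinearMap)

/-- `coeffHom f ⟨m⟩ = ⟨f m⟩` (Hatcher 2002, §2.2). [cite: Hatcher2002, §2.2] -/
@[simp]
lemma coeffHom_apply (f : M →ₗ[R] N) (m : ULift.{u} M) :
    coeffHom f m = ULift.up (f m.down) := rfl

/-- `coeffHom` of the identity is the identity (Hatcher 2002, §2.2). [cite: Hatcher2002, §2.2] -/
@[simp]
lemma coeffHom_id : coeffHom (LinearMap.id : M →ₗ[R] M) = 𝟙 (ModuleCat.of R (ULift.{u} M)) := rfl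

/-- `coeffHom` is compatible with composition (Hatcher 2002, §2.2). [cite: Hatcher2002, §2.2] -/
lemma coeffHom_comp (f : M →ₗ[R] N) (g : N →ₗ[R] P) :
    coeffHom.{u} (g ∘ₗ f) = coeffHom f ≫ coeffHom g := rfl

/-- `coeffHom 0 = 0` (Hatcher 2002, §2.2). [cite: Hatcher2002, §2.2] -/
@[simp]
lemma coeffHom_zero : coeffHom.{u} (0 : M →ₗ[R] N) = 0 := rfl

/-! ### Change of coefficients on singular chains -/

namespace singularChainComplex

variable (X) in
/-- The chain map `f_♯ : C_•(X; M) ⟶ C_•(X; N)` induced by a homomorphism of coefficient modules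
`f : M →ₗ[R] N`, `∑ mᵢ σᵢ ↦ ∑ f(mᵢ) σᵢ` (Hatcher 2002, §2.2, p. 153 and Lemma 2.49 context):
Mathlib's `singularChainComplexFunctor`, which is a functor in the coefficient object, applied to
`coeffHom f` and evaluated at `TopCat.of X`. [cite: Hatcher2002, §2.2  p. 153 and Lemma 2.49 context] -/
def mapCoeff (f : M →ₗ[R] N) : singularChainComplex R M X ⟶ singularChainComplex R N X :=
  ((singularChainComplexFunctor (ModuleCat.{max u v} R)).map (coeffHom f)).app (TopCat.of X)

variable {n : ℕ}

/-- `f_♯ (m • σ) = f(m) • σ` on elementary chains (Hatcher 2002, §2.2, p. 153). [cite: Hatcher2002, §2.2  p. 153] -/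
@[simp]
lemma mapCoeff_single (f : M →ₗ[R] N) (σ : SingularSimplex X n) (m : M) :
    (mapCoeff X f).f n (single (R := R) σ m) = single (R := R) σ (f m) := by
  change (Sigma.ι (fun _ : SingularSimplex X n ↦ ModuleCat.of R (ULift.{u} M)) σ ≫
    Limits.Sigma.map fun _ ↦ coeffHom f) (ULift.up m) = _
  rw [Limits.Sigma.ι_map]
  rfl

variable (X) in
/-- `(𝟙_M)_♯ = 𝟙` (Hatcher 2002, §2.2). [cite: Hatcher2002, §2.2] -/
@[simp]
lemma mapCoeff_id : mapCoeff X (LinearMap.id : M →ₗ[R] M) = 𝟙 _ := by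
  rw [mapCoeff, coeffHom_id, CategoryTheory.Functor.map_id]
  rfl

variable (X) in
/-- `(g ∘ f)_♯ = g_♯ ∘ f_♯` (Hatcher 2002, §2.2). [cite: Hatcher2002, §2.2] -/
@[reassoc]
lemma mapCoeff_comp (f : M →ₗ[R] N) (g : N →ₗ[R] P) :
    mapCoeff X (g ∘ₗ f) = mapCoeff X f ≫ mapCoeff X g := by
  rw [mapCoeff, coeffHom_comp, CategoryTheory.Functor.map_comp]
  rfl

variable (X) in
/-- `0_♯ = 0` (Hatcher 2002, §2.2; the chain functor is additive in the coefficients). [cite: Hatcher2002, §2.2] -/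
@[simp]
lemma mapCoeff_zero : mapCoeff X (0 : M →ₗ[R] N) = 0 := by
  rw [mapCoeff, coeffHom_zero, CategoryTheory.Functor.map_zero]
  rfl

/-- Change of coefficients commutes with the chain maps induced by continuous maps:
`φ♯ ∘ f_♯ = f_♯ ∘ φ♯` (Hatcher 2002, §2.2, naturality); this is naturality of
`(singularChainComplexFunctor _).map (coeffHom f)`. [cite: Hatcher2002, §2.2  naturality] -/
@[reassoc]
lemma map_comp_mapCoeff (φ : C(X, Y)) (f : M →ₗ[R] N) :
    map R M φ ≫ mapCoeff Y f = mapCoeff X f ≫ map R N φ :=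
  ((singularChainComplexFunctor (ModuleCat.{max u v} R)).map (coeffHom f)).naturality
    (TopCat.ofHom φ)

/-- Change of coefficients commutes with the inclusion of chains of a subspace
(Hatcher 2002, §2.2). [cite: Hatcher2002, §2.2] -/
@[reassoc]
lemma subsetι_comp_mapCoeff (A : Set X) (f : M →ₗ[R] N) :
    subsetι R M X A ≫ mapCoeff X f = mapCoeff A f ≫ subsetι R N X A :=
  map_comp_mapCoeff _ f

end singularChainComplex

/-! ### Change of coefficients on singular homology -/

namespace singularHomology

variable (X) in
/-- The induced map `f_* : Hₙ(X; M) ⟶ Hₙ(X; N)` of a homomorphism of coefficient modules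
(Hatcher 2002, §2.2, p. 153). [cite: Hatcher2002, §2.2  p. 153] -/
def mapCoeff (f : M →ₗ[R] N) (n : ℕ) : singularHomology R M X n ⟶ singularHomology R N X n :=
  HomologicalComplex.homologyMap (singularChainComplex.mapCoeff X f) n

variable (X) in
/-- `(𝟙_M)_* = 𝟙` on `Hₙ(X; M)` (Hatcher 2002, §2.2). [cite: Hatcher2002, §2.2] -/
@[simp]
lemma mapCoeff_id (n : ℕ) : mapCoeff X (LinearMap.id : M →ₗ[R] M) n = 𝟙 _ := by
  rw [mapCoeff, singularChainComplex.mapCoeff_id, HomologicalComplex.homologyMap_id]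

variable (X) in
/-- `(g ∘ f)_* = g_* ∘ f_*` on `Hₙ(X; -)` (Hatcher 2002, §2.2). [cite: Hatcher2002, §2.2] -/
@[reassoc]
lemma mapCoeff_comp (f : M →ₗ[R] N) (g : N →ₗ[R] P) (n : ℕ) :
    mapCoeff X (g ∘ₗ f) n = mapCoeff X f n ≫ mapCoeff X g n := by
  rw [mapCoeff, singularChainComplex.mapCoeff_comp, HomologicalComplex.homologyMap_comp]
  rfl

/-- Naturality: `φ_* ∘ f_* = f_* ∘ φ_*` for a continuous map `φ` and a coefficient homomorphism
`f` (Hatcher 2002, §2.2). [cite: Hatcher2002, §2.2] -/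
@[reassoc]
lemma map_mapCoeff (φ : C(X, Y)) (f : M →ₗ[R] N) (n : ℕ) :
    map R M φ n ≫ mapCoeff Y f n = mapCoeff X f n ≫ map R N φ n := by
  rw [map, mapCoeff, ← HomologicalComplex.homologyMap_comp,
    singularChainComplex.map_comp_mapCoeff, HomologicalComplex.homologyMap_comp]
  rfl

end singularHomology

/-! ### Change of coefficients on relative singular homology -/

namespace relativeSingularChainComplex

variable (X) in
/-- The chain map `C_•(X, A; M) ⟶ C_•(X, A; N)` induced by a homomorphism of coefficient modules
(Hatcher 2002, §2.2, p. 153, relative version); `cokernel.map` of the absolute maps. [cite: Hatcher2002, §2.2  p. 153  relative version] -/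
def mapCoeff (A : Set X) (f : M →ₗ[R] N) :
    relativeSingularChainComplex R M X A ⟶ relativeSingularChainComplex R N X A :=
  cokernel.map _ _ (singularChainComplex.mapCoeff A f) (singularChainComplex.mapCoeff X f)
    (singularChainComplex.subsetι_comp_mapCoeff A f)

/-- `π ≫ mapCoeff = mapCoeff ≫ π` on relative chains (Hatcher 2002, §2.2). [cite: Hatcher2002, §2.2] -/
@[reassoc (attr := simp)]
lemma π_comp_mapCoeff (A : Set X) (f : M →ₗ[R] N) :
    π R M X A ≫ mapCoeff X A f = singularChainComplex.mapCoeff X f ≫ π R N X A :=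
  cokernel.π_desc _ _ _

variable (X) in
/-- `mapCoeff 𝟙 = 𝟙` on relative chains (Hatcher 2002, §2.2). [cite: Hatcher2002, §2.2] -/
@[simp]
lemma mapCoeff_id (A : Set X) : mapCoeff X A (LinearMap.id : M →ₗ[R] M) = 𝟙 _ := by
  haveI := epi_π R M (X := X) A
  rw [← cancel_epi (π R M X A), π_comp_mapCoeff, singularChainComplex.mapCoeff_id]
  simp

variable (X) in
/-- `mapCoeff (g ∘ f) = mapCoeff f ≫ mapCoeff g` on relative chains (Hatcher 2002, §2.2). [cite: Hatcher2002, §2.2] -/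
@[reassoc]
lemma mapCoeff_comp (A : Set X) (f : M →ₗ[R] N) (g : N →ₗ[R] P) :
    mapCoeff X A (g ∘ₗ f) = mapCoeff X A f ≫ mapCoeff X A g := by
  haveI := epi_π R M (X := X) A
  rw [← cancel_epi (π R M X A), π_comp_mapCoeff, π_comp_mapCoeff_assoc, π_comp_mapCoeff,
    singularChainComplex.mapCoeff_comp, Category.assoc]

end relativeSingularChainComplex

namespace relativeSingularHomology

variable (X) in
/-- The induced map `f_* : Hₙ(X, A; M) ⟶ Hₙ(X, A; N)` of a homomorphism of coefficient modules
(Hatcher 2002, §2.2, p. 153). [cite: Hatcher2002, §2.2  p. 153] -/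
def mapCoeff (A : Set X) (f : M →ₗ[R] N) (n : ℕ) :
    relativeSingularHomology R M X A n ⟶ relativeSingularHomology R N X A n :=
  HomologicalComplex.homologyMap (relativeSingularChainComplex.mapCoeff X A f) n

variable (X) in
/-- `(𝟙_M)_* = 𝟙` on `Hₙ(X, A; M)` (Hatcher 2002, §2.2). [cite: Hatcher2002, §2.2] -/
@[simp]
lemma mapCoeff_id (A : Set X) (n : ℕ) : mapCoeff X A (LinearMap.id : M →ₗ[R] M) n = 𝟙 _ := by
  rw [mapCoeff, relativeSingularChainComplex.mapCoeff_id, HomologicalComplex.homologyMap_id]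

variable (X) in
/-- `(g ∘ f)_* = g_* ∘ f_*` on `Hₙ(X, A; -)` (Hatcher 2002, §2.2). [cite: Hatcher2002, §2.2] -/
@[reassoc]
lemma mapCoeff_comp (A : Set X) (f : M →ₗ[R] N) (g : N →ₗ[R] P) (n : ℕ) :
    mapCoeff X A (g ∘ₗ f) n = mapCoeff X A f n ≫ mapCoeff X A g n := by
  rw [mapCoeff, relativeSingularChainComplex.mapCoeff_comp, HomologicalComplex.homologyMap_comp]
  rfl

/-- `j_*` commutes with change of coefficients (Hatcher 2002, §2.2). [cite: Hatcher2002, §2.2] -/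
@[reassoc]
lemma ofAbsolute_comp_mapCoeff (A : Set X) (f : M →ₗ[R] N) (n : ℕ) :
    ofAbsolute R M X A n ≫ mapCoeff X A f n =
      singularHomology.mapCoeff X f n ≫ ofAbsolute R N X A n := by
  rw [ofAbsolute, mapCoeff, ← HomologicalComplex.homologyMap_comp,
    relativeSingularChainComplex.π_comp_mapCoeff, HomologicalComplex.homologyMap_comp]
  rfl

end relativeSingularHomology

/-! ### Change of coefficients on singular cochains and cohomology -/

namespace singularCochainCosimplicial

variable (X) in
/-- The morphism of cosimplicial modules `C^•(X; M) ⟶ C^•(X; N)` induced by `f : M →ₗ[R] N`,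
postcomposition `φ ↦ f ∘ φ` (Hatcher 2002, §3.1, p. 198, change of coefficient group). [cite: Hatcher2002, §3.1  p. 198  change of coefficient grou] -/
def mapCoeff (f : M →ₗ[R] N) :
    singularCochainCosimplicial R M X ⟶ singularCochainCosimplicial R N X where
  app d := ModuleCat.ofHom (f.compLeft ((TopCat.toSSet.obj (TopCat.of X)).obj (op d)))
  naturality _ _ _ := rfl

end singularCochainCosimplicial

namespace singularCochainComplex

variable (X) in
/-- The cochain map `f_♯ : C^•(X; M) ⟶ C^•(X; N)` induced by a homomorphism of coefficient
modules, `φ ↦ f ∘ φ` (Hatcher 2002, §3.1, p. 198): the alternating coface map complex functor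
applied to `singularCochainCosimplicial.mapCoeff X f`. [cite: Hatcher2002, §3.1  p. 198] -/
def mapCoeff (f : M →ₗ[R] N) : singularCochainComplex R M X ⟶ singularCochainComplex R N X :=
  (alternatingCofaceMapComplex _).map (singularCochainCosimplicial.mapCoeff X f)

variable {n : ℕ}

/-- `(f_♯ φ)(σ) = f (φ σ)` (Hatcher 2002, §3.1, p. 198). [cite: Hatcher2002, §3.1  p. 198] -/
@[simp]
lemma mapCoeff_apply (f : M →ₗ[R] N) (φ : (singularCochainComplex R M X).X n)
    (σ : SingularSimplex X n) : (mapCoeff X f).f n φ σ = f (φ σ) :=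
  rfl

variable (X) in
/-- `(𝟙_M)_♯ = 𝟙` on cochains (Hatcher 2002, §3.1). [cite: Hatcher2002, §3.1] -/
@[simp]
lemma mapCoeff_id : mapCoeff X (LinearMap.id : M →ₗ[R] M) = 𝟙 _ := by
  ext n φ σ
  simp

variable (X) in
/-- `(g ∘ f)_♯ = g_♯ ∘ f_♯` on cochains (Hatcher 2002, §3.1). [cite: Hatcher2002, §3.1] -/
@[reassoc]
lemma mapCoeff_comp (f : M →ₗ[R] N) (g : N →ₗ[R] P) :
    mapCoeff X (g ∘ₗ f) = mapCoeff X f ≫ mapCoeff X g := by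
  ext n φ σ
  simp

/-- Change of coefficients commutes with pull-back of cochains: `φ^♯ ∘ f_♯ = f_♯ ∘ φ^♯`
(Hatcher 2002, §3.1). [cite: Hatcher2002, §3.1] -/
@[reassoc]
lemma map_comp_mapCoeff (φ : C(X, Y)) (f : M →ₗ[R] N) :
    map R M φ ≫ mapCoeff X f = mapCoeff Y f ≫ map R N φ := by
  ext n ψ σ
  simp

end singularCochainComplex

namespace singularCohomology

variable (X) in
/-- The induced map `f_* : Hⁿ(X; M) ⟶ Hⁿ(X; N)` of a homomorphism of coefficient modules
(Hatcher 2002, §3.1, p. 198). [cite: Hatcher2002, §3.1  p. 198] -/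
def mapCoeff (f : M →ₗ[R] N) (n : ℕ) : singularCohomology R M X n ⟶ singularCohomology R N X n :=
  HomologicalComplex.homologyMap (singularCochainComplex.mapCoeff X f) n

variable (X) in
/-- `(𝟙_M)_* = 𝟙` on `Hⁿ(X; M)` (Hatcher 2002, §3.1). [cite: Hatcher2002, §3.1] -/
@[simp]
lemma mapCoeff_id (n : ℕ) : mapCoeff X (LinearMap.id : M →ₗ[R] M) n = 𝟙 _ := by
  rw [mapCoeff, singularCochainComplex.mapCoeff_id, HomologicalComplex.homologyMap_id]
  rfl

variable (X) in
/-- `(g ∘ f)_* = g_* ∘ f_*` on `Hⁿ(X; -)` (Hatcher 2002, §3.1). [cite: Hatcher2002, §3.1] -/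
@[reassoc]
lemma mapCoeff_comp (f : M →ₗ[R] N) (g : N →ₗ[R] P) (n : ℕ) :
    mapCoeff X (g ∘ₗ f) n = mapCoeff X f n ≫ mapCoeff X g n := by
  rw [mapCoeff, singularCochainComplex.mapCoeff_comp, HomologicalComplex.homologyMap_comp]
  rfl

/-- Naturality: `φ^* ∘ f_* = f_* ∘ φ^*` for a continuous map `φ` and a coefficient homomorphism
`f` (Hatcher 2002, §3.1). [cite: Hatcher2002, §3.1] -/
@[reassoc]
lemma map_mapCoeff (φ : C(X, Y)) (f : M →ₗ[R] N) (n : ℕ) :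
    map R M φ n ≫ mapCoeff X f n = mapCoeff Y f n ≫ map R N φ n := by
  change HomologicalComplex.homologyMap _ n ≫ HomologicalComplex.homologyMap _ n =
    HomologicalComplex.homologyMap _ n ≫ HomologicalComplex.homologyMap _ n
  rw [← HomologicalComplex.homologyMap_comp, singularCochainComplex.map_comp_mapCoeff,
    HomologicalComplex.homologyMap_comp]

end singularCohomology

/-! ### Universal coefficient statements -/

/-- **Universal coefficients over a field.** If `R` is a field and `Hₙ(X; R)` is finite
dimensional, the Kronecker pairing `Hⁿ(X; R) × Hₙ(X; R) → R` is a perfect pairing, i.e. both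
`Hⁿ(X; R) → Hom_R(Hₙ(X; R), R)` and `Hₙ(X; R) → Hom_R(Hⁿ(X; R), R)` are bijective
(Hatcher 2002, §3.1, Thm. 3.2 with `Ext` vanishing over a field, and §3.A; the second
bijectivity uses finite dimensionality). [cite: Hatcher2002, §3.1  Thm. 3.2 with  Ext  vanishing over] -/
def isPerfPair_kroneckerPairing_of_field : Prop :=
  ∀ {R : Type v} [Field R] {X : Type u} [TopologicalSpace X] (n : ℕ) [Module.Finite R (singularHomology R R X n)],
    (kroneckerPairing R R X n).IsPerfPair

variable (R M X) in
/-- **Universal coefficients for flat coefficient modules.** If `M` is a flat `R`-module then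
`Hₙ(X; M) ≅ Hₙ(X; R) ⊗[R] M` (Hatcher 2002, §3.A, Thm. 3A.3 and Cor. 3A.4: the universal
coefficient sequence `0 → Hₙ(X; R) ⊗ M → Hₙ(X; M) → Tor(Hₙ₋₁(X; R), M) → 0`, whose `Tor` term
vanishes for flat `M`; directly, `- ⊗[R] M` is exact and commutes with homology). The tensor
product of the carrier of `Hₙ(X; R) : ModuleCat.{max u v} R` with `M : Type v` lives in
`Type (max u v)`, so no `ULift` is needed. [cite: Hatcher2002, §3.A  Thm. 3A.3 and Cor. 3A.4: the unive] -/
def nonempty_singularHomology_iso_tensor : Prop :=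
  ∀ [Module.Flat R M] (n : ℕ),
    Nonempty (singularHomology R M X n ≅
      ModuleCat.of R (singularHomology R R X n ⊗[R] M))

/-! ### The Bockstein homomorphism -/

section Bockstein

variable (X) (f : M →ₗ[R] N) (g : N →ₗ[R] P)

/-- The short complex of singular chain complexes `C_•(X; M) ⟶ C_•(X; N) ⟶ C_•(X; P)` induced by
a pair of coefficient homomorphisms `M → N → P` with `g ∘ f = 0` (Hatcher 2002, §3.E, p. 303). [cite: Hatcher2002, §3.E  p. 303] -/
def singularChainComplex.mapCoeffShortComplex (hfg : g ∘ₗ f = 0) :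
    ShortComplex (ChainComplex (ModuleCat.{max u v} R) ℕ) :=
  ShortComplex.mk (singularChainComplex.mapCoeff X f) (singularChainComplex.mapCoeff X g)
    (by rw [← singularChainComplex.mapCoeff_comp, hfg, singularChainComplex.mapCoeff_zero])

/-- A short exact sequence of coefficient modules `0 → M → N → P → 0` induces a short exact
sequence of singular chain complexes `0 → C_•(X; M) → C_•(X; N) → C_•(X; P) → 0`, because
`Cₙ(X; -) = ⨁_σ (-)` is exact (Hatcher 2002, §3.E, p. 303, and §2.2). [cite: Hatcher2002, §3.E  p. 303  and §2.2] -/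
def shortExact_mapCoeff : Prop :=
  ∀ (hfg : Function.Exact f g) (hf : Function.Injective f) (hg : Function.Surjective g),
    (singularChainComplex.mapCoeffShortComplex X f g hfg.linearMap_comp_eq_zero).ShortExact

/-- The **Bockstein homomorphism** `β : Hₙ₊₁(X; P) ⟶ Hₙ(X; M)` associated with a short exact
sequence of coefficient modules `0 → M →ᶠ N →ᵍ P → 0`: the connecting homomorphism of the long
exact homology sequence of `0 → C_•(X; M) → C_•(X; N) → C_•(X; P) → 0`
(Hatcher 2002, §3.E, p. 303; e.g. `ℤ/p → ℤ/p² → ℤ/p` or `ℤ → ℤ → ℤ/p` at `R := ℤ`);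
Mathlib's `ShortComplex.ShortExact.δ`.
Takes the named fact `shortExact_mapCoeff X f g` (D-0014) as the explicit hypothesis `hS`. [cite: Hatcher2002, §3.E  p. 303] -/
def bockstein (hS : shortExact_mapCoeff X f g) (hfg : Function.Exact f g) (hf : Function.Injective f)
    (hg : Function.Surjective g) (n : ℕ) :
    singularHomology R P X (n + 1) ⟶ singularHomology R M X n :=
  (hS hfg hf hg).δ (n + 1) n rfl

/-- `g_* ≫ β = 0`: the Bockstein kills classes that lift to `N`-coefficients
(Hatcher 2002, §3.E, exactness of the long exact coefficient sequence). [cite: Hatcher2002, §3.E  exactness of the long exact coeffi] -/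
@[reassoc (attr := simp)]
lemma mapCoeff_comp_bockstein (hS : shortExact_mapCoeff X f g) (hfg : Function.Exact f g)
    (hf : Function.Injective f) (hg : Function.Surjective g) (n : ℕ) :
    singularHomology.mapCoeff X g (n + 1) ≫ bockstein X f g hS hfg hf hg n = 0 :=
  (hS hfg hf hg).comp_δ (n + 1) n rfl

/-- `β ≫ f_* = 0` (Hatcher 2002, §3.E, exactness of the long exact coefficient sequence). [cite: Hatcher2002, §3.E  exactness of the long exact coeffi] -/
@[reassoc (attr := simp)]
lemma bockstein_comp_mapCoeff (hS : shortExact_mapCoeff X f g) (hfg : Function.Exact f g)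
    (hf : Function.Injective f) (hg : Function.Surjective g) (n : ℕ) :
    bockstein X f g hS hfg hf hg n ≫ singularHomology.mapCoeff X f n = 0 :=
  (hS hfg hf hg).δ_comp (n + 1) n rfl

/-- Exactness of `Hₙ₊₁(X; N) ⟶ Hₙ₊₁(X; P) ⟶ Hₙ(X; M)` in the long exact coefficient sequence
(Hatcher 2002, §3.E, p. 303). [cite: Hatcher2002, §3.E  p. 303] -/
theorem exact_mapCoeff_bockstein (hS : shortExact_mapCoeff X f g) (hfg : Function.Exact f g)
    (hf : Function.Injective f) (hg : Function.Surjective g) (n : ℕ) :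
    (ShortComplex.mk _ _ (mapCoeff_comp_bockstein X f g hS hfg hf hg n)).Exact :=
  (hS hfg hf hg).homology_exact₃ (n + 1) n rfl

/-- Exactness of `Hₙ₊₁(X; P) ⟶ Hₙ(X; M) ⟶ Hₙ(X; N)` in the long exact coefficient sequence
(Hatcher 2002, §3.E, p. 303). [cite: Hatcher2002, §3.E  p. 303] -/
theorem exact_bockstein_mapCoeff (hS : shortExact_mapCoeff X f g) (hfg : Function.Exact f g)
    (hf : Function.Injective f) (hg : Function.Surjective g) (n : ℕ) :
    (ShortComplex.mk _ _ (bockstein_comp_mapCoeff X f g hS hfg hf hg n)).Exact :=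
  (hS hfg hf hg).homology_exact₁ (n + 1) n rfl

end Bockstein

end Literature.AlgebraicTopology.SingularHomology
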